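import Literature.NumberTheory.LFunctions.RHClassicalEquivalents
import Literature.NumberTheory.LFunctions.LevinsonMontgomeryTheorem
import Literature.NumberTheory.LFunctions.ZetaLowHeightZeros.Zeta0to4
import Literature.NumberTheory.LFunctions.ZetaLowHeightZeros.Zeta4to7h
import Literature.NumberTheory.LFunctions.ZetaLowHeightZeros.Zeta7hto11
import Literature.NumberTheory.LFunctions.ZetaLowHeightZeros.DZeta0to3
import Literature.NumberTheory.LFunctions.ZetaLowHeightZeros.DZeta3to5h
import Literature.NumberTheory.LFunctions.ZetaLowHeightZeros.DZeta5hto8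
import Literature.NumberTheory.LFunctions.ZetaLowHeightZeros.DZeta8to10h
import HarnessLib

/-!
# rh.S18 discharged: Speiser's theorem `RH ↔ ζ'(s) ≠ 0 for 0 < Re s < ½`

Trunk T-ANT (`NumberTheory/LFunctions`), family RH. Companion ("Proofs") file of
`Literature/NumberTheory/LFunctions/RHClassicalEquivalents.lean` for its **rh.S18** named fact
`Literature.NumberTheory.LFunctions.speiser_iff` (A. Speiser, Math. Ann. 110 (1934/35); proof along N. Levinson,
H. L. Montgomery, *Zeros of the derivatives of the Riemann zeta-function*, Acta Math. 133 (1974),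
Theorem 1 and its Corollary). The sibling files `RHClassicalEquivalentsProofs.lean` (rh.S27) and
`RHClassicalEquivalentsVonKochProofs.lean` (rh.S19) are independent of this one.

The chain of tree results assembled here:

* `LevinsonMontgomeryTheorem.lean`: Levinson–Montgomery's Theorem 1 (1.1) proved
  (`levinsonMontgomery_thm1_isBigO_holds`: argument principle on `[0, ½-δ] × [t₁, t₂]`,
  the sign lemmas for `Re ζ'/ζ` of `LevinsonMontgomerySigns.lean` — Hadamard product
  `HadamardGenusZeroProofs.lean`, Stirling-type digamma bound `DigammaGauss.lean` — and Backlund's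
  `O(log T)` bound `LevinsonMontgomeryBacklund.lean`), and (1.2) reduced to two low-height facts
  (`levinsonMontgomery_thm1_seq_of`);
* the seven kernel-checked certificates `ZetaLowHeightZeros/*.lean` (Euler–Maclaurin
  enclosures `ZetaLowHeightZeros.lean` in the fixed-point interval arithmetic
  `Analysis/ValidatedNumerics/FixedPointInterval.lean`, and the winding-number certificate
  theorem `Analysis/Complex/WindingCertificate.lean`), giving `ζ ≠ 0` on `(0,½) × (0, 11]` and
  `ζ' ≠ 0` on `(0,½) × (0, 10.5]` — the classical numerical inputs (Gram 1903, Spira 1965) of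
  Levinson–Montgomery's proof, here recomputed and certified;
* `LevinsonMontgomery.lean`: the Corollary (Speiser's theorem) from Theorem 1
  (`speiser_iff_of_levinsonMontgomery_thm1`, with the real-axis facts `ζ(σ) ≠ 0`, `ζ'(σ) ≠ 0`
  proved there and the open-strip description of the non-trivial zeros `ZetaZerosProofs.lean`).

## Main results

* `Literature.NumberTheory.LFunctions.riemannZeta_ne_zero_lowHeight` — `ζ(s) ≠ 0` for `0 < Re s < ½`, `0 < Im s ≤ 21/2`;
* `Literature.NumberTheory.LFunctions.deriv_riemannZeta_ne_zero_lowHeight` — `ζ'(s) ≠ 0` for `0 < Re s < ½`, `0 < Im s ≤ 10`;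
* `Literature.NumberTheory.LFunctions.levinsonMontgomery_thm1_seq_holds` — discharge of Levinson–Montgomery (1.2);
* `Literature.NumberTheory.LFunctions.speiser_iff_holds` — **discharge of rh.S18**.

All depend only on the axioms `propext`, `Classical.choice`, `Quot.sound`. The file has no
definitions.

## References

* A. Speiser, *Geometrisches zur Riemannschen Zetafunktion*, Math. Ann. 110 (1934/35), 514–521.
* N. Levinson, H. L. Montgomery, *Zeros of the derivatives of the Riemann zeta-function*, Acta
  Math. 133 (1974), 49–65, Theorem 1 and Corollary.
-/

namespace Literature.NumberTheory.LFunctions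

open ZetaLowHeightZeros.ZetaNum

/-- **`ζ(s) ≠ 0` for `0 < Re s < ½`, `0 < Im s ≤ 21/2`** (certified computation: the three
certificates on `(0,4]`, `(4, 15/2]`, `(15/2, 11]`; classically Gram 1903, i.e. the tree's
`Literature.RiemannHypothesisInStripUpTo 50`, cf. `speiser_iff_of_rhUpTo_spira`). [folklore] -/
theorem riemannZeta_ne_zero_lowHeight :
    ∀ s : ℂ, 0 < s.re → s.re < 1 / 2 → 0 < s.im → s.im ≤ 21 / 2 → riemannZeta s ≠ 0 := by
  intro s h0 h1 h2 h3
  rcases le_or_gt s.im 4 with h4 | h4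
  · exact riemannZeta_ne_zero_Zeta0to4 h0 h1 h2 h4
  rcases le_or_gt s.im (15 / 2) with h5 | h5
  · exact riemannZeta_ne_zero_Zeta4to7h h0 h1 h4 h5
  · exact riemannZeta_ne_zero_Zeta7hto11 h0 h1 h5 (by linarith)

/-- **`ζ'(s) ≠ 0` for `0 < Re s < ½`, `0 < Im s ≤ 10`** (certified computation: the four
certificates on `(0,3]`, `(3, 11/2]`, `(11/2, 8]`, `(8, 21/2]`; classically Spira 1965, cf. the
named fact `spira1965_deriv_riemannZeta_ne_zero`). [folklore] -/
theorem deriv_riemannZeta_ne_zero_lowHeight :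
    ∀ s : ℂ, 0 < s.re → s.re < 1 / 2 → 0 < s.im → s.im ≤ 10 → deriv riemannZeta s ≠ 0 := by
  intro s h0 h1 h2 h3
  rcases le_or_gt s.im 3 with h4 | h4
  · exact deriv_riemannZeta_ne_zero_DZeta0to3 h0 h1 h2 h4
  rcases le_or_gt s.im (11 / 2) with h5 | h5
  · exact deriv_riemannZeta_ne_zero_DZeta3to5h h0 h1 h4 h5
  rcases le_or_gt s.im 8 with h6 | h6
  · exact deriv_riemannZeta_ne_zero_DZeta5hto8 h0 h1 h5 h6
  · exact deriv_riemannZeta_ne_zero_DZeta8to10h h0 h1 h6 (by linarith)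

/-- **Levinson–Montgomery, Theorem 1 (1.2), proved**: unless `N⁻(T) > T/2` for all large `T`,
there is `T_j → ∞` with `N₁⁻(T_j) = N⁻(T_j)` (`levinsonMontgomery_thm1_seq_of` and the two
certified low-height facts). [cite: LevinsonMontgomery1974, Thm. 1 (1.2)] -/
theorem levinsonMontgomery_thm1_seq_holds : levinsonMontgomery_thm1_seq :=
  levinsonMontgomery_thm1_seq_of riemannZeta_ne_zero_lowHeight deriv_riemannZeta_ne_zero_lowHeight

/-- **rh.S18, proved — Speiser's theorem**: the Riemann Hypothesis is equivalent to `ζ'(s)`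
having no zeros in the open half-strip `0 < Re s < ½` (Speiser 1934; Levinson–Montgomery 1974,
Corollary to Theorem 1). [cite: Speiser1934, Satz (via LevinsonMontgomery1974 Thm 1)] -/
theorem speiser_iff_holds : speiser_iff :=
  speiser_iff_of_lowHeight riemannZeta_ne_zero_lowHeight deriv_riemannZeta_ne_zero_lowHeight

end Literature.NumberTheory.LFunctions
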